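import Literature.NumberTheory.PAdicHodge.UnramifiedCompletionEmbedding
import Literature.NumberTheory.GaloisRepresentations.LocalFieldPadicProofs
import Mathlib.NumberTheory.Padics.Complex
import Mathlib.Analysis.AbsoluteValue.Equivalence
import HarnessLib

/-!
# The tree's `ℂ_F` for `F = ℚ_p` IS Mathlib's `ℂ_[p]`: the field identification
# `CompletedAlgClosure ℚ_[p] ≃+* ℂ_[p]` (bicontinuous, unit balls and open unit balls correspond)

Topic `NumberTheory/PAdicHodge`; namespace `Literature.NumberTheory.PAdicHodge`. Cell `bsd-print-cf2`
(HOME `run/shared/lean/pub/bsd-print-cf2/`), seat `bsd-line-cf2-p1-w7` g7; the SEAM of cf2c-w4 g5's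
`Cruxes/TwoVariableMainConjAtSplitTwoQuad/ASSEMBLY-GUIDE-measure-side-w4g5.md` (GAP-2, «identification with
Mathlib's `ℂ_[2]`»). The module docstring of `CompletedAlgClosure.lean` says: «For `F = ℚ_p` this is
(isometrically isomorphic to) Mathlib's `ℂ_[p]`; we do not identify the two here.» This file DOES identify
them — with one honest correction: the tree's absolute value on `ℚ_[p]`
(`IsNonarchimedeanLocalField.nontriviallyNormedField`, built from an unspecified rank-one embedding
`IsRankLeOne.nonempty.some` of the value group) is only a POWER `‖·‖_p ^ s` (`0 < s`) of Mathlib's `p`-adic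
norm, so the identification is a bicontinuous field isomorphism under which norms correspond by
`‖θ z‖ ^ s = ‖z‖`; in particular closed and open unit balls (and the value `1`) correspond exactly, which is
all the Lubin–Tate point theory uses.

WHY (the seam): the points of the comparison `ϑ : Ĝ_m ≅ F_{f'}` (de Shalit I §3.2–3.3) are read by the
tree in `𝔪_ℂ ⊂ 𝒪_{ℂ_F}` (`LubinTateComparisonPoints`, `…AddPoints`, `…ReflectionTwo`, `LubinTateRootsOf
UnityTorsion`), while the measure-side criterion (`PAdicOneVariableTraceCriterion*.lean`) is stated over
normed `ℚ_[p]`-algebras `𝕜` (`[NormedAlgebra ℚ_[p] 𝕜]`), which `ℂ_F` is not (its norm restricted to `ℚ_[p]`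
is `‖·‖_p ^ s`); `θ` carries every point identity of `ℂ_F` to `ℂ_[p]`.

Construction (Neukirch II (3.3): two absolute values with the same unit ball are equivalent, `|·|₁ = |·|₂^s`;
II (4.8): uniqueness of the extension to `F̄`; completion is functorial in uniformly continuous maps):

* §1 `exists_padicNorm_rpow_eq_algNorm_algebraMap` — `∃ s > 0, ‖x‖_p ^ s = ‖x‖_tree` on `ℚ_[p]` (both unit
  balls are `𝒪[ℚ_[p]] = ℤ_p`: tree `algNorm_algebraMap_le_one_iff`, `Padic.mem_valuationInteger_iff`; Mathlib
  `AbsoluteValue.isEquiv_iff_exists_rpow_eq`); `exists_padicNorm_rpow_eq_algNorm` — the same `s` on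
  `F̄ = PadicAlgCl p`: `‖x‖ ^ s = algNorm ℚ_[p] x` (`(algNorm)^{1/s}` is an absolute value extending `‖·‖_p`,
  Mathlib `spectralNorm_unique_field_norm_ext`);
* §2 `NormedAlgClosure.equivPadicAlgCl` — the identity `F̄ → F̄` as a ring isomorphism
  `NormedAlgClosure ℚ_[p] ≃+* PadicAlgCl p`, uniformly continuous both ways;
* §3 **`CompletedAlgClosure.equivPadicComplex : CompletedAlgClosure ℚ_[p] ≃+* ℂ_[p]`** (Mathlib
  `UniformSpace.Completion.mapRingEquiv`), continuous with continuous inverse, extending the identity of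
  `F̄` (`equivPadicComplex_coe`, `equivPadicComplex_algClosureToC`) and of `ℚ_[p]`
  (`equivPadicComplex_algebraMap`); `exists_norm_equivPadicComplex_rpow_eq` (`‖θ z‖ ^ s = ‖z‖`),
  `norm_equivPadicComplex_le_one_iff` / `_lt_one_iff` / `_eq_one_iff`.

HONEST FRAMING: infrastructure (no number theory); BSD is not advanced by this file.

## References
* [NeukirchANT1999] J. Neukirch, *Algebraic Number Theory*, Ch. II Prop. (3.3) (equivalent absolute values:
  same open unit ball ⟺ `|·|₁ = |·|₂^s`), Thm. (4.8) (unique extension to algebraic extensions).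
* [FontaineOuyang2022] J.-M. Fontaine, Y. Ouyang, *Theory of p-adic Galois representations*, §3.1 (the field
  `C = ℂ_p` as the completion of `ℚ̄_p`).
-/

noncomputable section

open ValuativeRel Field UniformSpace

namespace Literature.NumberTheory.PAdicHodge

open Literature.NumberTheory.GaloisRepresentations
open Literature.NumberTheory.GaloisRepresentations.IsNonarchimedeanLocalField

variable (p : ℕ) [hp : Fact p.Prime]

/-! ### §1 The two absolute values on `ℚ_[p]` and on `F̄` differ by a power -/

section NormComparison

/-- **`‖x‖_p ^ s = ‖x‖_tree` on `ℚ_[p]` for some `s > 0`**: Mathlib's `p`-adic norm and the tree's valuation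
norm of the local field `ℚ_[p]` (read through `algNorm ℚ_[p] ∘ algebraMap`, tree `algNorm_algebraMap`) have
the same closed unit ball `𝒪[ℚ_[p]]`, hence are equivalent absolute values.
[cite: NeukirchANT1999, Ch. II (3.3)] -/
theorem exists_padicNorm_rpow_eq_algNorm_algebraMap :
    haveI := Padic.isNonarchimedeanLocalField_holds p
    ∃ s : ℝ, 0 < s ∧ ∀ x : ℚ_[p],
      ‖x‖ ^ s = algNorm ℚ_[p] (algebraMap ℚ_[p] (AlgebraicClosure ℚ_[p]) x) := by
  haveI := Padic.isNonarchimedeanLocalField_holds p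
  set vM : AbsoluteValue ℚ_[p] ℝ := IsAbsoluteValue.toAbsoluteValue (norm : ℚ_[p] → ℝ) with hvMdef
  have hvM : ∀ x, vM x = ‖x‖ := fun x => rfl
  set vT : AbsoluteValue ℚ_[p] ℝ :=
    { toFun := fun x => algNorm ℚ_[p] (algebraMap ℚ_[p] (AlgebraicClosure ℚ_[p]) x)
      map_mul' := fun x y => by simp only [map_mul, algNorm_mul]
      nonneg' := fun x => algNorm_nonneg _
      eq_zero' := fun x => by
        simp only [algNorm_eq_zero_iff, map_eq_zero_iff _ (algebraMap ℚ_[p] _).injective]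
      add_le' := fun x y => by
        simp only [map_add]
        exact (algNorm_add_le _ _).trans
          (max_le_add_of_nonneg (algNorm_nonneg _) (algNorm_nonneg _)) } with hvTdef
  have hvT : ∀ x, vT x = algNorm ℚ_[p] (algebraMap ℚ_[p] (AlgebraicClosure ℚ_[p]) x) := fun x => rfl
  have hle : ∀ x, vM x ≤ 1 ↔ vT x ≤ 1 := fun x => by
    rw [hvT, hvM, algNorm_algebraMap_le_one_iff, Padic.mem_valuationInteger_iff]
  have hequiv : vM.IsEquiv vT := by
    intro x y
    rcases eq_or_ne y 0 with rfl | hy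
    · rw [map_zero, map_zero]
      constructor
      · intro h
        have hx : x = 0 := (map_eq_zero_iff_eq_zero vM).mp (le_antisymm h (vM.nonneg x))
        rw [hx, map_zero]
      · intro h
        have hx : x = 0 := (map_eq_zero_iff_eq_zero vT).mp (le_antisymm h (vT.nonneg x))
        rw [hx, map_zero]
    · rw [← div_le_one (vM.pos hy), ← div_le_one (vT.pos hy), ← map_div₀, ← map_div₀]
      exact hle _
  obtain ⟨c, hc, h⟩ := AbsoluteValue.isEquiv_iff_exists_rpow_eq.mp hequiv
  exact ⟨c, hc, fun x => by rw [← hvT x, ← hvM x]; exact congrFun h x⟩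

/-- **`‖x‖ ^ s = algNorm ℚ_[p] x` on `F̄`** with the SAME exponent: the absolute value `(algNorm ℚ_[p] ·)^{1/s}`
of `F̄ = PadicAlgCl p` extends Mathlib's `p`-adic norm, hence is Mathlib's spectral norm `‖·‖`
(`spectralNorm_unique_field_norm_ext`, `ℚ_[p]` complete). [cite: NeukirchANT1999, Ch. II (4.8)] -/
theorem exists_padicNorm_rpow_eq_algNorm :
    haveI := Padic.isNonarchimedeanLocalField_holds p
    ∃ s : ℝ, 0 < s ∧ (∀ x : ℚ_[p], ‖x‖ ^ s = algNorm ℚ_[p] (algebraMap ℚ_[p] (AlgebraicClosure ℚ_[p]) x)) ∧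
      ∀ x : PadicAlgCl p, ‖x‖ ^ s = algNorm ℚ_[p] x := by
  haveI := Padic.isNonarchimedeanLocalField_holds p
  obtain ⟨s, hs, hK⟩ := exists_padicNorm_rpow_eq_algNorm_algebraMap p
  refine ⟨s, hs, hK, fun x => ?_⟩
  set g : AbsoluteValue (PadicAlgCl p) ℝ :=
    { toFun := fun x => algNorm ℚ_[p] x ^ s⁻¹
      map_mul' := fun x y => by
        simp only [algNorm_mul]
        exact Real.mul_rpow (algNorm_nonneg _) (algNorm_nonneg _)
      nonneg' := fun x => Real.rpow_nonneg (algNorm_nonneg _) _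
      eq_zero' := fun x => by
        simp only [Real.rpow_eq_zero_iff_of_nonneg (algNorm_nonneg _), algNorm_eq_zero_iff]
        exact ⟨fun h => h.1, fun h => ⟨h, inv_ne_zero hs.ne'⟩⟩
      add_le' := fun x y => by
        have h1 : algNorm ℚ_[p] (x + y) ^ s⁻¹ ≤ (max (algNorm ℚ_[p] x) (algNorm ℚ_[p] y)) ^ s⁻¹ :=
          Real.rpow_le_rpow (algNorm_nonneg _) (algNorm_add_le x y) (inv_nonneg.mpr hs.le)
        refine h1.trans ?_
        rcases le_total (algNorm ℚ_[p] x) (algNorm ℚ_[p] y) with h | h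
        · rw [max_eq_right h]
          exact le_add_of_nonneg_left (Real.rpow_nonneg (algNorm_nonneg _) _)
        · rw [max_eq_left h]
          exact le_add_of_nonneg_right (Real.rpow_nonneg (algNorm_nonneg _) _) } with hgdef
  have hg : ∀ y : PadicAlgCl p, g y = algNorm ℚ_[p] y ^ s⁻¹ := fun y => rfl
  have hg_ext : ∀ c : ℚ_[p], g (algebraMap ℚ_[p] (PadicAlgCl p) c) = ‖c‖ := fun c => by
    rw [hg, ← hK c, Real.rpow_rpow_inv (norm_nonneg c) hs.ne']
  have hgx : algNorm ℚ_[p] x ^ s⁻¹ = ‖x‖ := by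
    rw [← hg, spectralNorm_unique_field_norm_ext hg_ext x, PadicAlgCl.spectralNorm_eq]
  rw [← hgx, Real.rpow_inv_rpow (algNorm_nonneg _) hs.ne']

end NormComparison

/-! ### §2 `F̄`: the identity `NormedAlgClosure ℚ_[p] ≃+* PadicAlgCl p` is uniformly bicontinuous -/

section AlgClosure

/-- **The identity of `F̄`** as a ring isomorphism between the tree's normed synonym `NormedAlgClosure ℚ_[p]`
and Mathlib's `PadicAlgCl p` (both are `AlgebraicClosure ℚ_[p]`; tree `NormedAlgClosure.toAlgClosure`).
[cite: NeukirchANT1999, Ch. II (4.8)] -/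
def NormedAlgClosure.equivPadicAlgCl :
    haveI := Padic.isNonarchimedeanLocalField_holds p
    NormedAlgClosure ℚ_[p] ≃+* PadicAlgCl p :=
  haveI := Padic.isNonarchimedeanLocalField_holds p
  (NormedAlgClosure.toAlgClosure (F := ℚ_[p])).toRingEquiv

/-- Unfolding: `equivPadicAlgCl x = toAlgClosure x` (the same element of `AlgebraicClosure ℚ_[p]`). [folklore] -/
private theorem NormedAlgClosure.equivPadicAlgCl_apply
    (x : haveI := Padic.isNonarchimedeanLocalField_holds p; NormedAlgClosure ℚ_[p]) :
    haveI := Padic.isNonarchimedeanLocalField_holds p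
    NormedAlgClosure.equivPadicAlgCl p x = NormedAlgClosure.toAlgClosure x := rfl

/-- **Norms on `F̄` correspond by the power `s`**: `‖equivPadicAlgCl x‖ ^ s = ‖x‖` (and `‖c‖_p ^ s = ‖c‖_tree`
on `ℚ_[p]`). [cite: NeukirchANT1999, Ch. II (4.8)] -/
theorem NormedAlgClosure.exists_norm_equivPadicAlgCl_rpow_eq :
    haveI := Padic.isNonarchimedeanLocalField_holds p
    ∃ s : ℝ, 0 < s ∧ (∀ x : ℚ_[p], ‖x‖ ^ s = algNorm ℚ_[p] (algebraMap ℚ_[p] (AlgebraicClosure ℚ_[p]) x)) ∧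
      ∀ x : NormedAlgClosure ℚ_[p], ‖NormedAlgClosure.equivPadicAlgCl p x‖ ^ s = ‖x‖ := by
  haveI := Padic.isNonarchimedeanLocalField_holds p
  obtain ⟨s, hs, hK, hL⟩ := exists_padicNorm_rpow_eq_algNorm p
  exact ⟨s, hs, hK, fun x => by rw [NormedAlgClosure.norm_def]; exact hL _⟩

/-- The identity `NormedAlgClosure ℚ_[p] → PadicAlgCl p` is uniformly continuous (`‖x − y‖_tree < ε^s ⟹
‖x − y‖_p < ε`). [cite: NeukirchANT1999, Ch. II (3.3)] -/
theorem NormedAlgClosure.uniformContinuous_equivPadicAlgCl :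
    haveI := Padic.isNonarchimedeanLocalField_holds p
    UniformContinuous (NormedAlgClosure.equivPadicAlgCl p) := by
  haveI := Padic.isNonarchimedeanLocalField_holds p
  obtain ⟨s, hs, -, hL⟩ := NormedAlgClosure.exists_norm_equivPadicAlgCl_rpow_eq p
  refine Metric.uniformContinuous_iff.mpr fun ε hε => ⟨ε ^ s, Real.rpow_pos_of_pos hε s, ?_⟩
  intro a b hab
  rw [dist_eq_norm] at hab ⊢
  rw [← map_sub, ← Real.rpow_lt_rpow_iff (norm_nonneg _) hε.le hs, hL (a - b)]
  exact hab

/-- The identity `PadicAlgCl p → NormedAlgClosure ℚ_[p]` is uniformly continuous (`‖x − y‖_p < ε^{1/s} ⟹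
‖x − y‖_tree < ε`). [cite: NeukirchANT1999, Ch. II (3.3)] -/
theorem NormedAlgClosure.uniformContinuous_equivPadicAlgCl_symm :
    haveI := Padic.isNonarchimedeanLocalField_holds p
    UniformContinuous (NormedAlgClosure.equivPadicAlgCl p).symm := by
  haveI := Padic.isNonarchimedeanLocalField_holds p
  obtain ⟨s, hs, -, hL⟩ := NormedAlgClosure.exists_norm_equivPadicAlgCl_rpow_eq p
  refine Metric.uniformContinuous_iff.mpr fun ε hε => ⟨ε ^ s⁻¹, Real.rpow_pos_of_pos hε _, ?_⟩
  intro a b hab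
  rw [dist_eq_norm] at hab ⊢
  rw [← map_sub, ← hL, RingEquiv.apply_symm_apply]
  calc ‖a - b‖ ^ s < (ε ^ s⁻¹) ^ s := Real.rpow_lt_rpow (norm_nonneg _) hab hs
    _ = ε := Real.rpow_inv_rpow hε.le hs.ne'

end AlgClosure

/-! ### §3 `ℂ_F ≃+* ℂ_[p]` -/

section Completion

/-- **The field identification `θ : ℂ_F ≃+* ℂ_[p]` for `F = ℚ_p`**: Mathlib's
`UniformSpace.Completion.mapRingEquiv` of the uniformly bicontinuous identity `F̄ ≃+* F̄`
(`NormedAlgClosure.equivPadicAlgCl`). [cite: FontaineOuyang2022, §3.1] -/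
def CompletedAlgClosure.equivPadicComplex :
    haveI := Padic.isNonarchimedeanLocalField_holds p
    CompletedAlgClosure ℚ_[p] ≃+* ℂ_[p] :=
  haveI := Padic.isNonarchimedeanLocalField_holds p
  Completion.mapRingEquiv (NormedAlgClosure.equivPadicAlgCl p)
    (NormedAlgClosure.uniformContinuous_equivPadicAlgCl p).continuous
    (NormedAlgClosure.uniformContinuous_equivPadicAlgCl_symm p).continuous

/-- Unfolding: `θ z = Completion.map (equivPadicAlgCl) z`. [folklore] -/
private theorem CompletedAlgClosure.equivPadicComplex_apply
    (z : haveI := Padic.isNonarchimedeanLocalField_holds p; CompletedAlgClosure ℚ_[p]) :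
    haveI := Padic.isNonarchimedeanLocalField_holds p
    CompletedAlgClosure.equivPadicComplex p z = Completion.map (NormedAlgClosure.equivPadicAlgCl p) z := rfl

/-- Unfolding: `θ⁻¹ y = Completion.map (equivPadicAlgCl⁻¹) y`. [folklore] -/
private theorem CompletedAlgClosure.equivPadicComplex_symm_apply (y : ℂ_[p]) :
    haveI := Padic.isNonarchimedeanLocalField_holds p
    (CompletedAlgClosure.equivPadicComplex p).symm y =
      Completion.map (NormedAlgClosure.equivPadicAlgCl p).symm y := rfl

/-- `θ` is continuous. [cite: FontaineOuyang2022, §3.1] -/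
theorem CompletedAlgClosure.continuous_equivPadicComplex :
    haveI := Padic.isNonarchimedeanLocalField_holds p
    Continuous (CompletedAlgClosure.equivPadicComplex p) := by
  haveI := Padic.isNonarchimedeanLocalField_holds p
  show Continuous fun z => CompletedAlgClosure.equivPadicComplex p z
  simp only [CompletedAlgClosure.equivPadicComplex_apply]
  exact Completion.continuous_map

/-- `θ⁻¹` is continuous. [cite: FontaineOuyang2022, §3.1] -/
theorem CompletedAlgClosure.continuous_equivPadicComplex_symm :
    haveI := Padic.isNonarchimedeanLocalField_holds p
    Continuous (CompletedAlgClosure.equivPadicComplex p).symm := by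
  haveI := Padic.isNonarchimedeanLocalField_holds p
  show Continuous fun y => (CompletedAlgClosure.equivPadicComplex p).symm y
  simp only [CompletedAlgClosure.equivPadicComplex_symm_apply]
  exact Completion.continuous_map

/-- **`θ` extends the identity of `F̄`**: `θ ↑x = ↑x` for `x ∈ F̄` (`↑` the two completion maps).
[cite: FontaineOuyang2022, §3.1] -/
theorem CompletedAlgClosure.equivPadicComplex_coe
    (x : haveI := Padic.isNonarchimedeanLocalField_holds p; NormedAlgClosure ℚ_[p]) :
    haveI := Padic.isNonarchimedeanLocalField_holds p
    CompletedAlgClosure.equivPadicComplex p (x : CompletedAlgClosure ℚ_[p]) =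
      ((NormedAlgClosure.equivPadicAlgCl p x : PadicAlgCl p) : ℂ_[p]) := by
  haveI := Padic.isNonarchimedeanLocalField_holds p
  rw [CompletedAlgClosure.equivPadicComplex_apply,
    Completion.map_coe (NormedAlgClosure.uniformContinuous_equivPadicAlgCl p)]

/-- `θ⁻¹ ↑x = ↑x` for `x ∈ F̄`. [cite: FontaineOuyang2022, §3.1] -/
theorem CompletedAlgClosure.equivPadicComplex_symm_coe (x : PadicAlgCl p) :
    haveI := Padic.isNonarchimedeanLocalField_holds p
    (CompletedAlgClosure.equivPadicComplex p).symm (x : ℂ_[p]) =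
      (((NormedAlgClosure.equivPadicAlgCl p).symm x : NormedAlgClosure ℚ_[p]) : CompletedAlgClosure ℚ_[p]) := by
  haveI := Padic.isNonarchimedeanLocalField_holds p
  rw [CompletedAlgClosure.equivPadicComplex_symm_apply,
    Completion.map_coe (NormedAlgClosure.uniformContinuous_equivPadicAlgCl_symm p)]

/-- **`θ` extends the tree's `F̄ → ℂ_F`** (`algClosureToC`): `θ (algClosureToC ℚ_[p] x) = ↑x` for
`x : PadicAlgCl p = AlgebraicClosure ℚ_[p]`. [cite: FontaineOuyang2022, §3.1] -/
theorem CompletedAlgClosure.equivPadicComplex_algClosureToC (x : PadicAlgCl p) :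
    haveI := Padic.isNonarchimedeanLocalField_holds p
    CompletedAlgClosure.equivPadicComplex p (algClosureToC ℚ_[p] x) = (x : ℂ_[p]) := by
  haveI := Padic.isNonarchimedeanLocalField_holds p
  rw [algClosureToC_apply, CompletedAlgClosure.equivPadicComplex_coe]
  rfl

/-- **`θ` is the identity on `ℚ_[p]`**: `θ (algebraMap ℚ_[p] ℂ_F c) = (c : ℂ_[p])`. [cite: FontaineOuyang2022, §3.1] -/
theorem CompletedAlgClosure.equivPadicComplex_algebraMap (c : ℚ_[p]) :
    haveI := Padic.isNonarchimedeanLocalField_holds p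
    CompletedAlgClosure.equivPadicComplex p (algebraMap ℚ_[p] (CompletedAlgClosure ℚ_[p]) c) = (c : ℂ_[p]) := by
  haveI := Padic.isNonarchimedeanLocalField_holds p
  rw [CompletedAlgClosure.algebraMap_eq_coe, CompletedAlgClosure.equivPadicComplex_coe]
  rfl

/-- **Norms correspond by the power `s`**: `‖θ z‖ ^ s = ‖z‖` for all `z ∈ ℂ_F` (by density from `F̄`), with
the exponent `s > 0` of §1 (`‖c‖_p ^ s = ‖c‖_tree` on `ℚ_[p]`). [cite: NeukirchANT1999, Ch. II (4.8)] -/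
theorem CompletedAlgClosure.exists_norm_equivPadicComplex_rpow_eq :
    haveI := Padic.isNonarchimedeanLocalField_holds p
    ∃ s : ℝ, 0 < s ∧ (∀ x : ℚ_[p], ‖x‖ ^ s = algNorm ℚ_[p] (algebraMap ℚ_[p] (AlgebraicClosure ℚ_[p]) x)) ∧
      ∀ z : CompletedAlgClosure ℚ_[p], ‖CompletedAlgClosure.equivPadicComplex p z‖ ^ s = ‖z‖ := by
  haveI := Padic.isNonarchimedeanLocalField_holds p
  obtain ⟨s, hs, hK, hL⟩ := NormedAlgClosure.exists_norm_equivPadicAlgCl_rpow_eq p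
  refine ⟨s, hs, hK, fun z => ?_⟩
  refine Completion.induction_on z
    (isClosed_eq (((continuous_norm.comp (CompletedAlgClosure.continuous_equivPadicComplex p))).rpow_const
      fun _ => Or.inr hs.le) continuous_norm) ?_
  intro a
  rw [CompletedAlgClosure.equivPadicComplex_coe, Completion.norm_coe, Completion.norm_coe]
  exact hL a

/-- **Closed unit balls correspond**: `‖θ z‖ ≤ 1 ↔ ‖z‖ ≤ 1`. [cite: NeukirchANT1999, Ch. II (3.3)] -/
theorem CompletedAlgClosure.norm_equivPadicComplex_le_one_iff
    (z : haveI := Padic.isNonarchimedeanLocalField_holds p; CompletedAlgClosure ℚ_[p]) :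
    haveI := Padic.isNonarchimedeanLocalField_holds p
    ‖CompletedAlgClosure.equivPadicComplex p z‖ ≤ 1 ↔ ‖z‖ ≤ 1 := by
  haveI := Padic.isNonarchimedeanLocalField_holds p
  obtain ⟨s, hs, -, hL⟩ := CompletedAlgClosure.exists_norm_equivPadicComplex_rpow_eq p
  rw [← hL z, ← Real.one_rpow s, Real.rpow_le_rpow_iff (norm_nonneg _) zero_le_one hs, Real.one_rpow]

/-- **Open unit balls correspond**: `‖θ z‖ < 1 ↔ ‖z‖ < 1`. [cite: NeukirchANT1999, Ch. II (3.3)] -/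
theorem CompletedAlgClosure.norm_equivPadicComplex_lt_one_iff
    (z : haveI := Padic.isNonarchimedeanLocalField_holds p; CompletedAlgClosure ℚ_[p]) :
    haveI := Padic.isNonarchimedeanLocalField_holds p
    ‖CompletedAlgClosure.equivPadicComplex p z‖ < 1 ↔ ‖z‖ < 1 := by
  haveI := Padic.isNonarchimedeanLocalField_holds p
  obtain ⟨s, hs, -, hL⟩ := CompletedAlgClosure.exists_norm_equivPadicComplex_rpow_eq p
  rw [← hL z, ← Real.one_rpow s, Real.rpow_lt_rpow_iff (norm_nonneg _) zero_le_one hs, Real.one_rpow]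

/-- `‖θ z‖ = 1 ↔ ‖z‖ = 1`. [cite: NeukirchANT1999, Ch. II (3.3)] -/
theorem CompletedAlgClosure.norm_equivPadicComplex_eq_one_iff
    (z : haveI := Padic.isNonarchimedeanLocalField_holds p; CompletedAlgClosure ℚ_[p]) :
    haveI := Padic.isNonarchimedeanLocalField_holds p
    ‖CompletedAlgClosure.equivPadicComplex p z‖ = 1 ↔ ‖z‖ = 1 := by
  haveI := Padic.isNonarchimedeanLocalField_holds p
  rw [eq_iff_le_not_lt, eq_iff_le_not_lt, CompletedAlgClosure.norm_equivPadicComplex_le_one_iff,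
    CompletedAlgClosure.norm_equivPadicComplex_lt_one_iff]

/-- `‖θ⁻¹ y‖ ≤ 1 ↔ ‖y‖ ≤ 1`. [cite: NeukirchANT1999, Ch. II (3.3)] -/
theorem CompletedAlgClosure.norm_equivPadicComplex_symm_le_one_iff (y : ℂ_[p]) :
    haveI := Padic.isNonarchimedeanLocalField_holds p
    ‖(CompletedAlgClosure.equivPadicComplex p).symm y‖ ≤ 1 ↔ ‖y‖ ≤ 1 := by
  haveI := Padic.isNonarchimedeanLocalField_holds p
  rw [← CompletedAlgClosure.norm_equivPadicComplex_le_one_iff, RingEquiv.apply_symm_apply]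

/-- `‖θ⁻¹ y‖ < 1 ↔ ‖y‖ < 1`. [cite: NeukirchANT1999, Ch. II (3.3)] -/
theorem CompletedAlgClosure.norm_equivPadicComplex_symm_lt_one_iff (y : ℂ_[p]) :
    haveI := Padic.isNonarchimedeanLocalField_holds p
    ‖(CompletedAlgClosure.equivPadicComplex p).symm y‖ < 1 ↔ ‖y‖ < 1 := by
  haveI := Padic.isNonarchimedeanLocalField_holds p
  rw [← CompletedAlgClosure.norm_equivPadicComplex_lt_one_iff, RingEquiv.apply_symm_apply]

end Completion

end Literature.NumberTheory.PAdicHodge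

end
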